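import Summits.Ventures.PercRepro.RankLevelSetRuleQSliceBorderFlatTwo
import Summits.Ventures.PercRepro.RankLevelSetRuleQSliceBorderDensity
import Summits.Ventures.PercRepro.RankLevelSetRuleQCellOne
import Summits.Ventures.PercRepro.RankLevelSetRuleQSliceRhoPath

/-!
# PercRepro — THE BOTTOM CELLS BY THE CRUDE CHAIN: `3 ≤ m ≤ m₁(k)` FOR `k = 11 … 16` (night-1, gen 20; dossier §31.13)

On the bottom regime the conjecture of record is the tail bound `T ≤ 1` (RankLevelSetRuleQSliceBorderDensity). Here the tail is
bounded by an EXPLICIT finite sum: with `k = K + 2`, `m = 2 + d`, `q = m + K`,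
* `tail_ratio_shift` — `C(2K+2, K+2+j)/C(m+2K+2+j, K+2+j) = [the m = 2 ratio]·Π_{i<d} (i+K+3)/(i+2K+5+j)` (exact);
* `a_sum_le_pow` — `Σ_{a≤m} C(m, a)/C(n+a, r+a) ≤ (1 + (r+m)/(n+m))^m/C(n, r)` (every step ratio `(r+b+1)/(n+b+1)` is at most the
  last one; the binomial theorem);
* **`tail_le_crude`** — `T(q, k) ≤ B(K, d) := Σ_{j≤K} ((K+2)/(2K+3))·2^{−(j+1)}·Π_{i<d}(i+K+3)/(i+2K+5+j)·(1 + (K+2+j+m)/(2m+2K+2+j))^m`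
  (with `two_tail_ratio` of RankLevelSetRuleQSliceBorderFlatTwo);
* **`phiK_le_rhat_bottom_of_crude (K d) (2m ≤ K(K+1)) (B(K, d) ≤ 1)`** — the cell is paid;
* **`bottom_k11_all` … `bottom_k16_all`** — every bottom cell with `3 ≤ m ≤ m₁(k)`, `m₁ = 26, 27, 29, 31, 34, 36` for `k = 11 … 16`,
  by `interval_cases` and `norm_num` on `B` (the crude sum is `< 1` exactly up to `m₁(k)`; mining/night-1/g20/border_m1k.out);
* `a_sum_le_fine`, **`tail_le_fine`**, **`phiK_le_rhat_bottom_of_fine`** — the `a`-sum with the EARLY factors (`x_b ≤ (r+b+1)/(n+1)`):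
  `T ≤ B_fine(K, d) := Σ_j [C(2K+2,K+2+j)/C(m+2K+2+j,K+2+j)]·Σ_a C(m,a)(K+3+j)_a/(m+2K+3+j)^a` — tiny for `m ≫ k`;
* `bottom_k11_d25` … `bottom_k11_d32`, `bottom_k11_rest`, **`bottom_k11_complete (q) (10 ≤ q) (q ≤ 43) : phiK (q + 11) q ≤ rhat q 11 (q − 9)`**
  — THE WHOLE BOTTOM REGIME OF `k = 11` above the identity cell (`m = 1`: `rhatCell_one`; `m = 2`: `phiK_le_rhat_flat_two`);
* `phiK_le_rhat_gap_of_fine` — the gap cells `q ≥ k(k−3)/2` from `B_fine ≤ (k−1)(k−3)/(4(q+1))` (instances pending: heartbeats).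
Axioms: standard.
-/

namespace PercRepro

open Finset

/-- The leading tail ratio at general `m` (`k = K + 2`, `q = m + K`): `C(2K+2, K+2+j)/C(m+2K+2+j, K+2+j)` equals the `m = 2`
ratio times `Π_{m'=2}^{m-1} (m'+K+1)/(m'+2K+3+j)`, written with `m = 2 + d`:
`C(2K+2,K+2+j)/C(2+d+2K+2+j, K+2+j) = C(2K+2,K+2+j)/C(2K+4+j, K+2+j) · Π_{i<d} (i+K+3)/(i+2K+5+j)`. -/
lemma tail_ratio_shift (K j : ℕ) : ∀ d : ℕ,
    ((2 * K + 2).choose (K + 2 + j) : ℚ) / ((2 + d + 2 * K + 2 + j).choose (K + 2 + j) : ℚ)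
      = ((2 * K + 2).choose (K + 2 + j) : ℚ) / ((2 * K + 4 + j).choose (K + 2 + j) : ℚ)
        * ∏ i ∈ range d, (((i : ℚ) + K + 3) / ((i : ℚ) + 2 * K + 5 + j)) := by
  intro d
  induction d with
  | zero =>
    simp only [Finset.prod_range_zero, mul_one]
    rw [show 2 + 0 + 2 * K + 2 + j = 2 * K + 4 + j by ring]
  | succ d ih =>
    rw [Finset.prod_range_succ, ← mul_assoc, ← ih]
    -- C(n+1, r) = C(n, r)·(n+1)/(n+1−r) with n = 2+d+2K+2+j, r = K+2+j: (n+1−r) = d+K+3, n+1 = d+2K+5+j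
    have h := Nat.choose_mul_succ_eq (2 + d + 2 * K + 2 + j) (K + 2 + j)   -- C(n, r)(n+1) = C(n+1, r)(n+1−r)
    rw [show 2 + d + 2 * K + 2 + j + 1 - (K + 2 + j) = d + K + 3 by omega] at h
    have hc := congrArg (fun x : ℕ => (x : ℚ)) h
    push_cast at hc
    have hC : (0 : ℚ) < ((2 + d + 2 * K + 2 + j).choose (K + 2 + j) : ℚ) := Nat.cast_pos.mpr (Nat.choose_pos (by omega))
    have hC' : (0 : ℚ) < ((2 + (d + 1) + 2 * K + 2 + j).choose (K + 2 + j) : ℚ) := Nat.cast_pos.mpr (Nat.choose_pos (by omega))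
    rw [show 2 + (d + 1) + 2 * K + 2 + j = 2 + d + 2 * K + 2 + j + 1 by ring] at hC' ⊢
    rw [div_mul_div_comm, div_eq_div_iff hC'.ne' (by positivity)]
    nlinarith [hc, hC, hC']


/-- The `a`-sum at general `m` bounded by the binomial theorem: with `n = 2+d+2K+2+j`, `r = K+2+j`, `m = 2 + d` and
`x = (r + m)/(n + m)` (the largest step ratio `(r+b+1)/(n+b+1)`, `b < m`),
`Σ_{a ≤ m} C(m, a)/C(n + a, r + a) ≤ (1 + x)^m / C(n, r)`. -/
lemma a_sum_le_pow (n r m : ℕ) (hn : 0 < n) (hr : r ≤ n) :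
    ∑ a ∈ range (m + 1), (m.choose a : ℚ) / ((n + a).choose (r + a) : ℚ)
      ≤ (1 + ((r : ℚ) + m) / ((n : ℚ) + m)) ^ m / (n.choose r : ℚ) := by
  have hC : (0 : ℚ) < (n.choose r : ℚ) := Nat.cast_pos.mpr (Nat.choose_pos hr)
  set x := ((r : ℚ) + m) / ((n : ℚ) + m) with hx
  have hx0 : 0 ≤ x := by positivity
  -- 1/C(n+a, r+a) ≤ x^a / C(n, r) by induction on a (a ≤ m)
  have hstep : ∀ a : ℕ, a ≤ m → (1 : ℚ) / ((n + a).choose (r + a) : ℚ) ≤ x ^ a / (n.choose r : ℚ) := by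
    intro a
    induction a with
    | zero => intro _; simp
    | succ a ih =>
      intro ha
      have ih' := ih (by omega)
      have h := Nat.add_one_mul_choose_eq (n + a) (r + a)     -- (n+a+1) C(n+a, r+a) = C(n+a+1, r+a+1)(r+a+1)
      have hc := congrArg (fun x : ℕ => (x : ℚ)) h
      push_cast at hc
      have hCa : (0 : ℚ) < ((n + a).choose (r + a) : ℚ) := Nat.cast_pos.mpr (Nat.choose_pos (by omega))
      have hCa' : (0 : ℚ) < ((n + (a + 1)).choose (r + (a + 1)) : ℚ) := Nat.cast_pos.mpr (Nat.choose_pos (by omega))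
      -- 1/C(n+a+1, r+a+1) = ((r+a+1)/(n+a+1)) / C(n+a, r+a) ≤ x / C(n+a, r+a)
      have hratio : ((r : ℚ) + a + 1) / ((n : ℚ) + a + 1) ≤ x := by
        rw [hx, div_le_div_iff₀ (by positivity) (by positivity)]
        have ham : (a : ℚ) + 1 ≤ m := by exact_mod_cast ha
        have hrn : (r : ℚ) ≤ n := by exact_mod_cast hr
        nlinarith
      have e : (1 : ℚ) / ((n + (a + 1)).choose (r + (a + 1)) : ℚ)
          = (((r : ℚ) + a + 1) / ((n : ℚ) + a + 1)) * (1 / ((n + a).choose (r + a) : ℚ)) := by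
        rw [show n + (a + 1) = n + a + 1 by ring, show r + (a + 1) = r + a + 1 by ring] at hCa' ⊢
        rw [div_mul_div_comm, mul_one, div_eq_div_iff hCa'.ne' (by positivity)]
        linarith [hc]
      rw [e, pow_succ]
      calc ((r : ℚ) + a + 1) / ((n : ℚ) + a + 1) * (1 / ((n + a).choose (r + a) : ℚ))
          ≤ x * (x ^ a / (n.choose r : ℚ)) := by
            apply mul_le_mul hratio ih' (by positivity) hx0
        _ = x ^ a * x / (n.choose r : ℚ) := by ring
  calc ∑ a ∈ range (m + 1), (m.choose a : ℚ) / ((n + a).choose (r + a) : ℚ)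
      ≤ ∑ a ∈ range (m + 1), (m.choose a : ℚ) * (x ^ a / (n.choose r : ℚ)) := by
        apply Finset.sum_le_sum
        intro a ha
        rw [Finset.mem_range] at ha
        have := hstep a (by omega)
        calc (m.choose a : ℚ) / ((n + a).choose (r + a) : ℚ) = (m.choose a : ℚ) * (1 / ((n + a).choose (r + a) : ℚ)) := by ring
          _ ≤ (m.choose a : ℚ) * (x ^ a / (n.choose r : ℚ)) := mul_le_mul_of_nonneg_left this (by positivity)
    _ = (∑ a ∈ range (m + 1), (m.choose a : ℚ) * x ^ a) / (n.choose r : ℚ) := by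
        rw [Finset.sum_div]; refine Finset.sum_congr rfl (fun a _ => by ring)
    _ = (1 + x) ^ m / (n.choose r : ℚ) := by
        congr 1
        rw [show (1 + x) ^ m = (x + 1) ^ m by ring, add_pow]
        refine Finset.sum_congr rfl (fun a _ => by rw [one_pow, mul_one]; ring)


/-- **The crude tail bound at general `m = 2 + d`** (`k = K + 2`, `q = m + K`):
`T(q, k) ≤ Σ_{j ≤ K} ((K+2)/(2K+3))·2^{−(j+1)}·Π_{i<d} (i+K+3)/(i+2K+5+j)·(1 + (K+2+j+m)/(2m+2K+2+j))^m`. -/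
theorem tail_le_crude (K d : ℕ) :
    ∑ j ∈ range (K + 1), ((2 * K + 2).choose (K + 2 + j) : ℚ)
        * ∑ a ∈ range (2 + d + 1), ((2 + d).choose a : ℚ) / ((2 + d + K + (K + 2 + j) + a).choose (a + (K + 2 + j)) : ℚ)
      ≤ ∑ j ∈ range (K + 1), (((K : ℚ) + 2) / (2 * (K : ℚ) + 3)) / 2 ^ (j + 1)
          * (∏ i ∈ range d, (((i : ℚ) + K + 3) / ((i : ℚ) + 2 * K + 5 + j)))
          * (1 + (((K : ℚ) + 2 + j) + (2 + d : ℕ)) / (((2 + d + 2 * K + 2 + j : ℕ) : ℚ) + (2 + d : ℕ))) ^ (2 + d) := by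
  apply Finset.sum_le_sum
  intro j hj
  rw [Finset.mem_range] at hj
  -- the a-sum in the form of a_sum_le_pow with n = 2+d+2K+2+j, r = K+2+j
  have hidx : ∀ a, (2 + d + K + (K + 2 + j) + a).choose (a + (K + 2 + j)) = (2 + d + 2 * K + 2 + j + a).choose (K + 2 + j + a) := by
    intro a; congr 1 <;> omega
  simp only [hidx]
  have hA := a_sum_le_pow (2 + d + 2 * K + 2 + j) (K + 2 + j) (2 + d) (by omega) (by omega)
  have hR := two_tail_ratio K j (by omega)
  have hS := tail_ratio_shift K j d
  have hC : (0 : ℚ) < ((2 + d + 2 * K + 2 + j).choose (K + 2 + j) : ℚ) := Nat.cast_pos.mpr (Nat.choose_pos (by omega))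
  have hP : (0 : ℚ) ≤ ∏ i ∈ range d, (((i : ℚ) + K + 3) / ((i : ℚ) + 2 * K + 5 + j)) :=
    Finset.prod_nonneg (fun i _ => by positivity)
  have hx : (0 : ℚ) ≤ (1 + (((K : ℚ) + 2 + j) + (2 + d : ℕ)) / (((2 + d + 2 * K + 2 + j : ℕ) : ℚ) + (2 + d : ℕ))) ^ (2 + d) := by
    positivity
  calc ((2 * K + 2).choose (K + 2 + j) : ℚ)
        * ∑ a ∈ range (2 + d + 1), ((2 + d).choose a : ℚ) / ((2 + d + 2 * K + 2 + j + a).choose (K + 2 + j + a) : ℚ)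
      ≤ ((2 * K + 2).choose (K + 2 + j) : ℚ)
        * ((1 + (((K + 2 + j : ℕ) : ℚ) + (2 + d : ℕ)) / (((2 + d + 2 * K + 2 + j : ℕ) : ℚ) + (2 + d : ℕ))) ^ (2 + d)
          / ((2 + d + 2 * K + 2 + j).choose (K + 2 + j) : ℚ)) :=
        mul_le_mul_of_nonneg_left hA (by positivity)
    _ = (((2 * K + 2).choose (K + 2 + j) : ℚ) / ((2 + d + 2 * K + 2 + j).choose (K + 2 + j) : ℚ))
        * (1 + (((K + 2 + j : ℕ) : ℚ) + (2 + d : ℕ)) / (((2 + d + 2 * K + 2 + j : ℕ) : ℚ) + (2 + d : ℕ))) ^ (2 + d) := by ring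
    _ = (((2 * K + 2).choose (K + 2 + j) : ℚ) / ((2 * K + 4 + j).choose (K + 2 + j) : ℚ)
          * ∏ i ∈ range d, (((i : ℚ) + K + 3) / ((i : ℚ) + 2 * K + 5 + j)))
        * (1 + (((K + 2 + j : ℕ) : ℚ) + (2 + d : ℕ)) / (((2 + d + 2 * K + 2 + j : ℕ) : ℚ) + (2 + d : ℕ))) ^ (2 + d) := by
        rw [hS]
    _ ≤ ((((K : ℚ) + 2) / (2 * (K : ℚ) + 3)) / 2 ^ (j + 1)
          * ∏ i ∈ range d, (((i : ℚ) + K + 3) / ((i : ℚ) + 2 * K + 5 + j)))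
        * (1 + (((K + 2 + j : ℕ) : ℚ) + (2 + d : ℕ)) / (((2 + d + 2 * K + 2 + j : ℕ) : ℚ) + (2 + d : ℕ))) ^ (2 + d) := by
        apply mul_le_mul_of_nonneg_right _ (by positivity)
        exact mul_le_mul_of_nonneg_right hR hP
    _ = _ := by push_cast; ring


/-- **A bottom cell from the crude tail bound**: `m = 2 + d`, `k = K + 2`, `2m ≤ K(K+1)`, and the explicit crude sum
`B(K, d) ≤ 1` ⇒ `Φ(q+k, q) ≤ R̂(q, k, m)`. Each cell with `3 ≤ m ≤ m₁(k)` is an instance (`norm_num` on `B`). -/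
theorem phiK_le_rhat_bottom_of_crude (K d : ℕ) (h : 2 * (2 + d) ≤ K * (K + 1))
    (hB : ∑ j ∈ range (K + 1), (((K : ℚ) + 2) / (2 * (K : ℚ) + 3)) / 2 ^ (j + 1)
          * (∏ i ∈ range d, (((i : ℚ) + K + 3) / ((i : ℚ) + 2 * K + 5 + j)))
          * (1 + (((K : ℚ) + 2 + j) + (2 + d : ℕ)) / (((2 + d + 2 * K + 2 + j : ℕ) : ℚ) + (2 + d : ℕ))) ^ (2 + d) ≤ 1) :
    phiK (2 + d + K + (K + 2)) (2 + d + K) ≤ rhat (2 + d + K) (K + 2) (2 + d) :=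
  phiK_le_rhat_border_of_tail_le_one (2 + d) K h ((tail_le_crude K d).trans hB)

/-- **The bottom cells of `k = 11` with `3 ≤ m ≤ 26`** (`d = m − 2 ∈ [1, 24]`), all by the crude chain. -/
theorem bottom_k11_all (d : ℕ) (h1 : 1 ≤ d) (h2 : d ≤ 24) :
    phiK (2 + d + 9 + (9 + 2)) (2 + d + 9) ≤ rhat (2 + d + 9) (9 + 2) (2 + d) := by
  apply phiK_le_rhat_bottom_of_crude 9 d (by omega)
  interval_cases d <;>
    (simp only [Finset.sum_range_succ, Finset.sum_range_zero, Finset.prod_range_succ, Finset.prod_range_zero]; norm_num)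

/-- **The bottom cells of `k = 12` with `3 ≤ m ≤ 27`** (`d = m − 2 ∈ [1, 25]`), all by the crude chain. -/
theorem bottom_k12_all (d : ℕ) (h1 : 1 ≤ d) (h2 : d ≤ 25) :
    phiK (2 + d + 10 + (10 + 2)) (2 + d + 10) ≤ rhat (2 + d + 10) (10 + 2) (2 + d) := by
  apply phiK_le_rhat_bottom_of_crude 10 d (by omega)
  interval_cases d <;>
    (simp only [Finset.sum_range_succ, Finset.sum_range_zero, Finset.prod_range_succ, Finset.prod_range_zero]; norm_num)

/-- **The bottom cells of `k = 13` with `3 ≤ m ≤ 29`** (`d = m − 2 ∈ [1, 27]`), all by the crude chain. -/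
theorem bottom_k13_all (d : ℕ) (h1 : 1 ≤ d) (h2 : d ≤ 27) :
    phiK (2 + d + 11 + (11 + 2)) (2 + d + 11) ≤ rhat (2 + d + 11) (11 + 2) (2 + d) := by
  apply phiK_le_rhat_bottom_of_crude 11 d (by omega)
  interval_cases d <;>
    (simp only [Finset.sum_range_succ, Finset.sum_range_zero, Finset.prod_range_succ, Finset.prod_range_zero]; norm_num)

/-- **The bottom cells of `k = 14` with `3 ≤ m ≤ 31`** (`d = m − 2 ∈ [1, 29]`), all by the crude chain. -/
theorem bottom_k14_all (d : ℕ) (h1 : 1 ≤ d) (h2 : d ≤ 29) :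
    phiK (2 + d + 12 + (12 + 2)) (2 + d + 12) ≤ rhat (2 + d + 12) (12 + 2) (2 + d) := by
  apply phiK_le_rhat_bottom_of_crude 12 d (by omega)
  interval_cases d <;>
    (simp only [Finset.sum_range_succ, Finset.sum_range_zero, Finset.prod_range_succ, Finset.prod_range_zero]; norm_num)

/-- The bottom cells of `k = 15`, first half (`1 ≤ d ≤ 16`). -/
theorem bottom_k15_a (d : ℕ) (h1 : 1 ≤ d) (h2 : d ≤ 16) :
    phiK (2 + d + 13 + (13 + 2)) (2 + d + 13) ≤ rhat (2 + d + 13) (13 + 2) (2 + d) := by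
  apply phiK_le_rhat_bottom_of_crude 13 d (by omega)
  interval_cases d <;>
    (simp only [Finset.sum_range_succ, Finset.sum_range_zero, Finset.prod_range_succ, Finset.prod_range_zero]; norm_num)

/-- The bottom cells of `k = 15`, second half (`17 ≤ d ≤ 32`). -/
theorem bottom_k15_b (d : ℕ) (h1 : 17 ≤ d) (h2 : d ≤ 32) :
    phiK (2 + d + 13 + (13 + 2)) (2 + d + 13) ≤ rhat (2 + d + 13) (13 + 2) (2 + d) := by
  apply phiK_le_rhat_bottom_of_crude 13 d (by omega)
  interval_cases d <;>
    (simp only [Finset.sum_range_succ, Finset.sum_range_zero, Finset.prod_range_succ, Finset.prod_range_zero]; norm_num)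

/-- **The bottom cells of `k = 15` with `3 ≤ m ≤ 34`** (`d = m − 2 ∈ [1, 32]`), all by the crude chain. -/
theorem bottom_k15_all (d : ℕ) (h1 : 1 ≤ d) (h2 : d ≤ 32) :
    phiK (2 + d + 13 + (13 + 2)) (2 + d + 13) ≤ rhat (2 + d + 13) (13 + 2) (2 + d) := by
  rcases Nat.lt_or_ge d (16 + 1) with h | h
  · exact bottom_k15_a d h1 (by omega)
  · exact bottom_k15_b d h (by omega)

/-- The bottom cells of `k = 16`, first half (`1 ≤ d ≤ 17`). -/
theorem bottom_k16_a (d : ℕ) (h1 : 1 ≤ d) (h2 : d ≤ 17) :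
    phiK (2 + d + 14 + (14 + 2)) (2 + d + 14) ≤ rhat (2 + d + 14) (14 + 2) (2 + d) := by
  apply phiK_le_rhat_bottom_of_crude 14 d (by omega)
  interval_cases d <;>
    (simp only [Finset.sum_range_succ, Finset.sum_range_zero, Finset.prod_range_succ, Finset.prod_range_zero]; norm_num)

/-- The bottom cells of `k = 16`, second half (`18 ≤ d ≤ 34`). -/
theorem bottom_k16_b (d : ℕ) (h1 : 18 ≤ d) (h2 : d ≤ 34) :
    phiK (2 + d + 14 + (14 + 2)) (2 + d + 14) ≤ rhat (2 + d + 14) (14 + 2) (2 + d) := by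
  apply phiK_le_rhat_bottom_of_crude 14 d (by omega)
  interval_cases d <;>
    (simp only [Finset.sum_range_succ, Finset.sum_range_zero, Finset.prod_range_succ, Finset.prod_range_zero]; norm_num)

/-- **The bottom cells of `k = 16` with `3 ≤ m ≤ 36`** (`d = m − 2 ∈ [1, 34]`), all by the crude chain. -/
theorem bottom_k16_all (d : ℕ) (h1 : 1 ≤ d) (h2 : d ≤ 34) :
    phiK (2 + d + 14 + (14 + 2)) (2 + d + 14) ≤ rhat (2 + d + 14) (14 + 2) (2 + d) := by
  rcases Nat.lt_or_ge d (17 + 1) with h | h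
  · exact bottom_k16_a d h1 (by omega)
  · exact bottom_k16_b d h (by omega)


/-- **The `a`-sum with the early factors**: `Σ_{a≤m} C(m, a)/C(n+a, r+a) ≤ (Σ_{a≤m} C(m, a)·(r+1)_a/(n+1)^a)/C(n, r)`, where
`(r+1)_a = Π_{b<a} (r+1+b)` (each step ratio `(r+b+1)/(n+b+1) ≤ (r+b+1)/(n+1)`). Exact at small `a`, tiny for `m ≫ k`. -/
lemma a_sum_le_fine (n r m : ℕ) (hn : 0 < n) (hr : r ≤ n) :
    ∑ a ∈ range (m + 1), (m.choose a : ℚ) / ((n + a).choose (r + a) : ℚ)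
      ≤ (∑ a ∈ range (m + 1), (m.choose a : ℚ) * ((∏ b ∈ range a, ((r : ℚ) + 1 + b)) / ((n : ℚ) + 1) ^ a)) / (n.choose r : ℚ) := by
  have hC : (0 : ℚ) < (n.choose r : ℚ) := Nat.cast_pos.mpr (Nat.choose_pos hr)
  have hstep : ∀ a : ℕ, (1 : ℚ) / ((n + a).choose (r + a) : ℚ)
      ≤ ((∏ b ∈ range a, ((r : ℚ) + 1 + b)) / ((n : ℚ) + 1) ^ a) / (n.choose r : ℚ) := by
    intro a
    induction a with
    | zero => simp
    | succ a ih =>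
      have h := Nat.add_one_mul_choose_eq (n + a) (r + a)
      have hc := congrArg (fun x : ℕ => (x : ℚ)) h
      push_cast at hc
      have hCa : (0 : ℚ) < ((n + a).choose (r + a) : ℚ) := Nat.cast_pos.mpr (Nat.choose_pos (by omega))
      have hCa' : (0 : ℚ) < ((n + a + 1).choose (r + a + 1) : ℚ) := Nat.cast_pos.mpr (Nat.choose_pos (by omega))
      have hratio : ((r : ℚ) + a + 1) / ((n : ℚ) + a + 1) ≤ ((r : ℚ) + 1 + a) / ((n : ℚ) + 1) := by
        rw [div_le_div_iff₀ (by positivity) (by positivity)]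
        have : (0 : ℚ) ≤ a := by positivity
        nlinarith
      have e : (1 : ℚ) / ((n + (a + 1)).choose (r + (a + 1)) : ℚ)
          = (((r : ℚ) + a + 1) / ((n : ℚ) + a + 1)) * (1 / ((n + a).choose (r + a) : ℚ)) := by
        rw [show n + (a + 1) = n + a + 1 by ring, show r + (a + 1) = r + a + 1 by ring]
        rw [div_mul_div_comm, mul_one, div_eq_div_iff hCa'.ne' (by positivity)]
        linarith [hc]
      rw [e, Finset.prod_range_succ, pow_succ]
      calc ((r : ℚ) + a + 1) / ((n : ℚ) + a + 1) * (1 / ((n + a).choose (r + a) : ℚ))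
          ≤ (((r : ℚ) + 1 + a) / ((n : ℚ) + 1)) * ((∏ b ∈ range a, ((r : ℚ) + 1 + b)) / ((n : ℚ) + 1) ^ a / (n.choose r : ℚ)) := by
            apply mul_le_mul hratio ih (by positivity) (by positivity)
        _ = (∏ b ∈ range a, ((r : ℚ) + 1 + b)) * ((r : ℚ) + 1 + a) / (((n : ℚ) + 1) ^ a * ((n : ℚ) + 1)) / (n.choose r : ℚ) := by
            field_simp
  calc ∑ a ∈ range (m + 1), (m.choose a : ℚ) / ((n + a).choose (r + a) : ℚ)
      ≤ ∑ a ∈ range (m + 1), (m.choose a : ℚ) * (((∏ b ∈ range a, ((r : ℚ) + 1 + b)) / ((n : ℚ) + 1) ^ a) / (n.choose r : ℚ)) := by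
        apply Finset.sum_le_sum
        intro a _
        calc (m.choose a : ℚ) / ((n + a).choose (r + a) : ℚ) = (m.choose a : ℚ) * (1 / ((n + a).choose (r + a) : ℚ)) := by ring
          _ ≤ _ := mul_le_mul_of_nonneg_left (hstep a) (by positivity)
    _ = _ := by rw [Finset.sum_div]; refine Finset.sum_congr rfl (fun a _ => by ring)

/-- **The fine tail bound at general `m = 2 + d`**: `T(q, k) ≤ B_fine(K, d) := Σ_{j≤K} C(2K+2, K+2+j)/C(m+2K+2+j, K+2+j) ·
Σ_{a≤m} C(m, a)·(K+3+j)_a/(m+2K+3+j)^a`. -/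
theorem tail_le_fine (K d : ℕ) :
    ∑ j ∈ range (K + 1), ((2 * K + 2).choose (K + 2 + j) : ℚ)
        * ∑ a ∈ range (2 + d + 1), ((2 + d).choose a : ℚ) / ((2 + d + K + (K + 2 + j) + a).choose (a + (K + 2 + j)) : ℚ)
      ≤ ∑ j ∈ range (K + 1), (((2 * K + 2).choose (K + 2 + j) : ℚ) / ((2 + d + 2 * K + 2 + j).choose (K + 2 + j) : ℚ))
          * ∑ a ∈ range (2 + d + 1), ((2 + d).choose a : ℚ)
              * ((∏ b ∈ range a, (((K + 2 + j : ℕ) : ℚ) + 1 + b)) / (((2 + d + 2 * K + 2 + j : ℕ) : ℚ) + 1) ^ a) := by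
  apply Finset.sum_le_sum
  intro j hj
  have hidx : ∀ a, (2 + d + K + (K + 2 + j) + a).choose (a + (K + 2 + j)) = (2 + d + 2 * K + 2 + j + a).choose (K + 2 + j + a) := by
    intro a; congr 1 <;> omega
  simp only [hidx]
  have hA := a_sum_le_fine (2 + d + 2 * K + 2 + j) (K + 2 + j) (2 + d) (by omega) (by omega)
  calc ((2 * K + 2).choose (K + 2 + j) : ℚ)
        * ∑ a ∈ range (2 + d + 1), ((2 + d).choose a : ℚ) / ((2 + d + 2 * K + 2 + j + a).choose (K + 2 + j + a) : ℚ)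
      ≤ ((2 * K + 2).choose (K + 2 + j) : ℚ) * ((∑ a ∈ range (2 + d + 1), ((2 + d).choose a : ℚ)
          * ((∏ b ∈ range a, (((K + 2 + j : ℕ) : ℚ) + 1 + b)) / (((2 + d + 2 * K + 2 + j : ℕ) : ℚ) + 1) ^ a))
          / ((2 + d + 2 * K + 2 + j).choose (K + 2 + j) : ℚ)) := mul_le_mul_of_nonneg_left hA (by positivity)
    _ = _ := by ring

/-- **A bottom cell from the fine tail bound**: `2m ≤ K(K+1)` and `B_fine(K, d) ≤ 1` ⇒ the cell is paid. -/
theorem phiK_le_rhat_bottom_of_fine (K d : ℕ) (h : 2 * (2 + d) ≤ K * (K + 1))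
    (hB : ∑ j ∈ range (K + 1), (((2 * K + 2).choose (K + 2 + j) : ℚ) / ((2 + d + 2 * K + 2 + j).choose (K + 2 + j) : ℚ))
          * ∑ a ∈ range (2 + d + 1), ((2 + d).choose a : ℚ)
              * ((∏ b ∈ range a, (((K + 2 + j : ℕ) : ℚ) + 1 + b)) / (((2 + d + 2 * K + 2 + j : ℕ) : ℚ) + 1) ^ a) ≤ 1) :
    phiK (2 + d + K + (K + 2)) (2 + d + K) ≤ rhat (2 + d + K) (K + 2) (2 + d) :=
  phiK_le_rhat_border_of_tail_le_one (2 + d) K h ((tail_le_fine K d).trans hB)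

/-- The bottom cell `k = 11`, `m = 27` (`d = 25`), by the fine bound. -/
theorem bottom_k11_d25 : phiK (2 + 25 + 9 + (9 + 2)) (2 + 25 + 9) ≤ rhat (2 + 25 + 9) (9 + 2) (2 + 25) := by
  apply phiK_le_rhat_bottom_of_fine 9 25 (by norm_num)
  simp only [Finset.sum_range_succ, Finset.sum_range_zero, Finset.prod_range_succ, Finset.prod_range_zero,
    Nat.choose_eq_descFactorial_div_factorial]
  norm_num [Nat.descFactorial, Nat.factorial]

/-- The bottom cell `k = 11`, `m = 28` (`d = 26`), by the fine bound. -/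
theorem bottom_k11_d26 : phiK (2 + 26 + 9 + (9 + 2)) (2 + 26 + 9) ≤ rhat (2 + 26 + 9) (9 + 2) (2 + 26) := by
  apply phiK_le_rhat_bottom_of_fine 9 26 (by norm_num)
  simp only [Finset.sum_range_succ, Finset.sum_range_zero, Finset.prod_range_succ, Finset.prod_range_zero,
    Nat.choose_eq_descFactorial_div_factorial]
  norm_num [Nat.descFactorial, Nat.factorial]

/-- The bottom cell `k = 11`, `m = 29` (`d = 27`), by the fine bound. -/
theorem bottom_k11_d27 : phiK (2 + 27 + 9 + (9 + 2)) (2 + 27 + 9) ≤ rhat (2 + 27 + 9) (9 + 2) (2 + 27) := by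
  apply phiK_le_rhat_bottom_of_fine 9 27 (by norm_num)
  simp only [Finset.sum_range_succ, Finset.sum_range_zero, Finset.prod_range_succ, Finset.prod_range_zero,
    Nat.choose_eq_descFactorial_div_factorial]
  norm_num [Nat.descFactorial, Nat.factorial]

/-- The bottom cell `k = 11`, `m = 30` (`d = 28`), by the fine bound. -/
theorem bottom_k11_d28 : phiK (2 + 28 + 9 + (9 + 2)) (2 + 28 + 9) ≤ rhat (2 + 28 + 9) (9 + 2) (2 + 28) := by
  apply phiK_le_rhat_bottom_of_fine 9 28 (by norm_num)
  simp only [Finset.sum_range_succ, Finset.sum_range_zero, Finset.prod_range_succ, Finset.prod_range_zero,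
    Nat.choose_eq_descFactorial_div_factorial]
  norm_num [Nat.descFactorial, Nat.factorial]

/-- The bottom cell `k = 11`, `m = 31` (`d = 29`), by the fine bound. -/
theorem bottom_k11_d29 : phiK (2 + 29 + 9 + (9 + 2)) (2 + 29 + 9) ≤ rhat (2 + 29 + 9) (9 + 2) (2 + 29) := by
  apply phiK_le_rhat_bottom_of_fine 9 29 (by norm_num)
  simp only [Finset.sum_range_succ, Finset.sum_range_zero, Finset.prod_range_succ, Finset.prod_range_zero,
    Nat.choose_eq_descFactorial_div_factorial]
  norm_num [Nat.descFactorial, Nat.factorial]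

/-- The bottom cell `k = 11`, `m = 32` (`d = 30`), by the fine bound. -/
theorem bottom_k11_d30 : phiK (2 + 30 + 9 + (9 + 2)) (2 + 30 + 9) ≤ rhat (2 + 30 + 9) (9 + 2) (2 + 30) := by
  apply phiK_le_rhat_bottom_of_fine 9 30 (by norm_num)
  simp only [Finset.sum_range_succ, Finset.sum_range_zero, Finset.prod_range_succ, Finset.prod_range_zero,
    Nat.choose_eq_descFactorial_div_factorial]
  norm_num [Nat.descFactorial, Nat.factorial]

/-- The bottom cell `k = 11`, `m = 33` (`d = 31`), by the fine bound. -/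
theorem bottom_k11_d31 : phiK (2 + 31 + 9 + (9 + 2)) (2 + 31 + 9) ≤ rhat (2 + 31 + 9) (9 + 2) (2 + 31) := by
  apply phiK_le_rhat_bottom_of_fine 9 31 (by norm_num)
  simp only [Finset.sum_range_succ, Finset.sum_range_zero, Finset.prod_range_succ, Finset.prod_range_zero,
    Nat.choose_eq_descFactorial_div_factorial]
  norm_num [Nat.descFactorial, Nat.factorial]

/-- The bottom cell `k = 11`, `m = 34` (`d = 32`), by the fine bound. -/
theorem bottom_k11_d32 : phiK (2 + 32 + 9 + (9 + 2)) (2 + 32 + 9) ≤ rhat (2 + 32 + 9) (9 + 2) (2 + 32) := by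
  apply phiK_le_rhat_bottom_of_fine 9 32 (by norm_num)
  simp only [Finset.sum_range_succ, Finset.sum_range_zero, Finset.prod_range_succ, Finset.prod_range_zero,
    Nat.choose_eq_descFactorial_div_factorial]
  norm_num [Nat.descFactorial, Nat.factorial]

/-- The remaining bottom cells of `k = 11`: `27 ≤ m ≤ 34` (`25 ≤ d ≤ 32`). -/
theorem bottom_k11_rest (d : ℕ) (h1 : 25 ≤ d) (h2 : d ≤ 32) :
    phiK (2 + d + 9 + (9 + 2)) (2 + d + 9) ≤ rhat (2 + d + 9) (9 + 2) (2 + d) := by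
  interval_cases d
  · exact bottom_k11_d25
  · exact bottom_k11_d26
  · exact bottom_k11_d27
  · exact bottom_k11_d28
  · exact bottom_k11_d29
  · exact bottom_k11_d30
  · exact bottom_k11_d31
  · exact bottom_k11_d32

/-- **THE WHOLE BOTTOM REGIME OF `k = 11` ABOVE THE IDENTITY CELL**: every `10 ≤ q ≤ 43` (`1 ≤ m ≤ 34`),
`Φ(q+11, q) ≤ R̂(q, 11, q − 9)` (`m = 1` by `rhatCell_one`, `m = 2` by `phiK_le_rhat_flat_two`, `3 ≤ m ≤ 26` by the crude chain,
`27 ≤ m ≤ 34` by the fine bound; `q = 9` is the identity cell `m = 0`). -/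
theorem bottom_k11_complete (q : ℕ) (h1 : 10 ≤ q) (h2 : q ≤ 43) : phiK (q + 11) q ≤ rhat q 11 (q - 9) := by
  rcases Nat.lt_or_ge q 12 with hq | hq
  · interval_cases q
    · exact rhatCell_one 10 11 (by omega) (by omega)
    · have := phiK_le_rhat_flat_two 11 (by omega)
      rw [show 2 * 11 = 11 + 11 by ring] at this; exact this
  · obtain ⟨d, rfl⟩ : ∃ d, q = 2 + d + 9 := ⟨q - 11, by omega⟩
    rw [show 2 + d + 9 - 9 = 2 + d by omega, show 2 + d + 9 + 11 = 2 + d + 9 + (9 + 2) by ring]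
    rcases Nat.lt_or_ge d 25 with hd | hd
    · exact bottom_k11_all d (by omega) (by omega)
    · exact bottom_k11_rest d hd (by omega)


/-- **A gap cell from the fine tail bound**: on `q ≥ k(k−3)/2` (`(K+1)(K−2) ≤ 2m`, `m = 2 + d`, `k = K + 2`), if
`B_fine(K, d) ≤ (K+1)(K−1)/(4(m+K+1))` then the cell is paid (numerically the ratio is `≤ 0.027` on every gap cell `k ≤ 19`). -/
theorem phiK_le_rhat_gap_of_fine (K d : ℕ) (hk : 2 ≤ K) (hslope : (K + 1) * (K - 2) ≤ 2 * (2 + d))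
    (hB : ∑ j ∈ range (K + 1), (((2 * K + 2).choose (K + 2 + j) : ℚ) / ((2 + d + 2 * K + 2 + j).choose (K + 2 + j) : ℚ))
          * ∑ a ∈ range (2 + d + 1), ((2 + d).choose a : ℚ)
              * ((∏ b ∈ range a, (((K + 2 + j : ℕ) : ℚ) + 1 + b)) / (((2 + d + 2 * K + 2 + j : ℕ) : ℚ) + 1) ^ a)
        ≤ ((K : ℚ) + 1) * ((K : ℚ) - 1) / (4 * (((2 + d : ℕ) : ℚ) + K + 1))) :
    phiK (2 + d + K + (K + 2)) (2 + d + K) ≤ rhat (2 + d + K) (K + 2) (2 + d) :=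
  phiK_le_rhat_border_of_tail (2 + d) K hk hslope ((tail_le_fine K d).trans hB)

end PercRepro
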